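import Summits.CriticalPhenomena.SAWScalingLimit.Theses.SAWTargetMonotonicity
import Summits.CriticalPhenomena.SAWScalingLimit.Theorems.FKGToTraversalBound.Negative.R1Split
import Summits.CriticalPhenomena.SAWScalingLimit.Theorems.SAWLeftRightFKGFKGToTraversalBoundEventualShellReduction
import Literature.Probability.RandomPlanarGeometry.CrossingCondition

/-!
# Birth skeleton for the crux `SAWTargetMonotonicity.MonotoneRSW` (stmt-CriticalPhenomena-8255)

Route `route-CriticalPhenomena-SAWTargetMonotonicity` (sub-problem `SAWScalingLimit`), crux #4 (rank 4):

  `MonotoneRSW := TargetMonotone → DomainMonotone → (H1)`,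

where (H1) is the Aizenman–Burchard hypothesis for the critical square-lattice SAW chord — for every
Dobrushin domain `D` and EVERY endpoint approximation `(a_δ, b_δ)` (`SAW.IsEndpointApprox`) a
shell-dependent threshold `k(x,ρ,R)`, `K ≥ 0`, `λ > 2`, `δ₀ > 0` with
`P_δ[k(x,ρ,R) separate traversals of D(x;ρ,R)] ≤ K (ρ/R)^λ` for `δ ≤ δ₀`, `δ ≤ ρ < R ≤ 1` — verbatim the
shared support item `SAWTraversalBound` (stmt-CriticalPhenomena-1880; `Iff.rfl`, certified by refuter
rreview-89fa4785).  Registered by the skeleton registrar `planner-skel-stmt-CriticalPhenomena-8255-0`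
(2026-08-17, route re-audit bin REPAIRABLE); published as `Cruxes/MonotoneRSW/Lines/birth.lean`.

## The line in one paragraph (the route's own scheme (i)–(iv), typed in LANDED currencies)

The "FKG-free one-curve RSW engine" is cut at its two natural joints, both of which the tree already
names:

* **T1 `stub_symmetrisation` (XL, THE LEVER, open)** — steps (ii)–(iii) of the scheme: the two monotone
  couplings plus a reflection give Kemppainen–Smirnov's TIME-ZERO Condition G1 for the ADMISSIBLE family
  of critical SAW chord laws (simply connected polyomino cell domains, both endpoints boundary vertices):
  `TargetMonotone → DomainMonotone → AdmissibleG1`.  `AdmissibleG1` is VERBATIM the signature of the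
  open item stmt-CriticalPhenomena-11346 (`SAWParafermion.KSAdmissibleG1`, KS17 arXiv:1212.6215 eq. (4),
  §4.1.6) — the admissible family is closed under the SAW's exact domain Markov property
  `S ↦ S ∖ past` (step (i)), and a boundary tip in a simply connected polyomino is exactly the typed
  setting of `TargetMonotone` / `DomainMonotone` (source/targets left of the first darts of a primal
  lattice polygon), so this is the statement the symmetrisation argument must deliver and nothing more.
* **T2 `stub_ksIterationBdry` (L–XL, open)** — step (iv) at BOUNDARY-ATTACHED endpoints: time-zero G1
  over the Markov-closed admissible family ⇒ conditional G2 for the chord ⇒ geometric decay of repeated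
  unforced traversals (KS17 Prop. 2.6 / §3, Aizenman–Burchard App. A on the lattice) ⇒ for every Dobrushin
  domain, every endpoint approximation of the R1 class `BdryApprox` (both lattice endpoints eventually on
  the lattice boundary `meshBoundary`, `Negative.R1Split`) and every FIXED shell of modulus `≥ 2`, the
  traversal count is tight EVENTUALLY in `δ` (`PerShellTightBdry`; forced crossings near the marked prime
  ends and in fjords are absorbed into the `(D, shell, ε)`-dependent threshold — the static forcing
  allowance; the passage cell-domain ↔ Smirnov discretisation of a Jordan domain is part of the stub).
* **PROVED glue (tree)** — per-shell eventual tightness ⇒ (H1) for that approximation, by the landed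
  quantile chart `SlitNecklace.stub_eventualShellReduction` (p127535; `K = 8`, `λ = 3`): this turns T2's
  output into `Negative.SAWTraversalBoundBdry` (= (H1) on the R1 class).
* **T3 `stub_deepEndpointReduction` (open reduction, statement-level residue)** — (H1) on the R1 class ⇒
  (H1) for ALL endpoint approximations: definitionally `Negative.DeepEndpointReduction` (p82017), the
  residue on which EVERY line of the sibling crux `FKGToTraversalBound` stopped
  (`Negative.exists_approx_outside_R1`: the depth-`√δ` start of the unit disc is admissible and never a
  lattice-boundary vertex; no uniform-in-the-past engine is instantiated there).  The route's own device
  for it is step (iv)'s "interior starting points by conditioning on the walk up to its last exit from a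
  mesoscopic ball around the marked point" (cf. the sibling's slit-necklace / `GermTight`).

  MonotoneRSW ⇐ T3 ∘ (eventualShellReduction ∘ T2) ∘ T1        (`MonotoneRSW_of`, no `sorry`)

## BC3 audit (registrar, 2026-08-17; raw outputs in the registrar's NOTES.md)

* `lean check --json` of this file: rc 0, sorries = 3 = stubs (`stub_symmetrisation`,
  `stub_ksIterationBdry`, `stub_deepEndpointReduction`), zero elsewhere;
  `#print axioms MonotoneRSW_of` ⊆ {propext, Classical.choice, Quot.sound}.
* Probes (`bc/probe_<Stub>_{crux,summit}.lean`, `first | exact? | simpa | aesop` plain AND after unfolding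
  the stub / the crux, `maxHeartbeats 400000`): for each of the three stubs `stub → MonotoneRSW` FAILS and
  `stub → _root_.SAWScalingLimit` FAILS (6/6) — no stub is cheaply the crux or the summit.

## Disproof used / negatives honoured

No `Cruxes/MonotoneRSW/Disproof.lean` and no `Lines/*` existed at registration (`ledger crux ls`: no
workfiles).  Honoured from the sibling cruxes with the SAME conclusion (stmt-1880):
* `FKGToTraversalBound/Negative/R1Split` + `DeepEndpointGap` + `DeepStartNotPresentable`: the engine (T1–T2)
  is only asked on `BdryApprox`; the deep fragment is the separate stub T3 (= `DeepEndpointReduction`).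
* `HexTight/Negative/LatticeG2False` (ring counterexample: G2 fails with HOLES): `AdmissibleG1` quantifies
  over SIMPLY CONNECTED polyominoes only (`S` and `Sᶜ` preconnected), time zero, no floating past.
* `ShellCrossingBound/Negative/UniformThresholdFalse` (one threshold for all shells is false by boundary
  forcing): every threshold here depends on `(D, a, b, x, ρ, R, ε)`; stmt-CriticalPhenomena-0772 (all-`δ`
  tightness refuted): every statement here is EVENTUAL in `δ`.
* `FKGToTraversalBound/EngineNeedsBubble` (lead finding F-B): a uniform-in-the-carrier unforced-crossing
  bound accepts the neck-and-room carriers and implies the ceiling critical bubble bound — recorded as the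
  "why it might fail" of T1 (TM ∧ DM would then carry bubble-grade information), not a refutation.
-/

noncomputable section

open MeasureTheory Filter Topology Set Metric
open scoped NNReal ENNReal
open Literature.Probability.LatticeModels
open Literature.Probability.RandomPlanarGeometry
open Summit.CriticalPhenomena.SAWScalingLimit.Theses.SAWTargetMonotonicity
  (TargetMonotone DomainMonotone MonotoneRSW)
open Summit.CriticalPhenomena.SAWScalingLimit.Theorems.FKGToTraversalBound.Negative
  (H1At BdryApprox SAWTraversalBoundBdry DeepEndpointReduction)
open Summit.CriticalPhenomena.SAWScalingLimit.Theorems.FKGToTraversalBound.SlitNecklace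
  (stub_eventualShellReduction)

namespace Summit.CriticalPhenomena.SAWScalingLimit.Cruxes.MonotoneRSW.Birth

/-! ## §0 Vocabulary of the line (two named statements; everything else is by name from the tree) -/

/-- **Kemppainen–Smirnov's time-zero Condition G1 for the ADMISSIBLE family of critical SAW chord laws**
— VERBATIM the signature of item stmt-CriticalPhenomena-11346 (`SAWParafermion.KSAdmissibleG1`; not
imported so that this skeleton does not depend on that route file; agreement is `Iff.rfl`, checked in the
registrar's `bc/g1_verbatim.lean`): there is `C > 1` such that for every finite `S ⊆ ℤ²` inducing a
connected subgraph with connected complement (a simply connected polyomino), every mesh `δ > 0`, all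
BOUNDARY vertices `a, b` of `S` and every annulus `A(z₀; r, R)` with `R ≥ C r`, the critical SAW in the
cell domain `U(S,δ) = interior ⋃_{v ∈ S} (closed δ-squares)` from `a` to `b` makes a crossing of `A`
inside the avoidable part `A^u` (KS eq. (3)) with probability `≤ 1/2`.
[KemppainenSmirnov2017 arXiv:1212.6215 eq. (3)–(4), §4.1.3–4.1.6; stmt-CriticalPhenomena-11346] -/
def AdmissibleG1 : Prop :=
  Literature.Probability.RandomPlanarGeometry.ConditionG1 {L : Literature.Probability.RandomPlanarGeometry.MarkedLaw | ∃ (S : Finset (Literature.Probability.LatticeModels.Site 2)) (δ : ℝ) (a b : Literature.Probability.LatticeModels.Site 2), let U : Set ℂ := interior (⋃ v ∈ S, {z : ℂ | |z.re - (Literature.Probability.LatticeModels.meshPoint δ v).re| ≤ δ / 2 ∧ |z.im - (Literature.Probability.LatticeModels.meshPoint δ v).im| ≤ δ / 2}); 0 < δ ∧ ((Literature.Probability.LatticeModels.zdGraph 2).induce (↑S : Set (Literature.Probability.LatticeModels.Site 2))).Preconnected ∧ ((Literature.Probability.LatticeModels.zdGraph 2).induce ((↑S : Set (Literature.Probability.LatticeModels.Site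 2))ᶜ)).Preconnected ∧ a ∈ S ∧ b ∈ S ∧ (∃ w ∉ S, (Literature.Probability.LatticeModels.zdGraph 2).Adj a w) ∧ (∃ w ∉ S, (Literature.Probability.LatticeModels.zdGraph 2).Adj b w) ∧ L = ⟨U, Literature.Probability.LatticeModels.meshPoint δ a, Literature.Probability.LatticeModels.meshPoint δ b, (Literature.Probability.RandomPlanarGeometry.SAW.law U δ a b).map (fun γ => γ.curve)⟩}

/-- **Per-shell EVENTUAL tightness of the traversal counts, for one endpoint approximation** — exactly the
hypothesis of the landed `SlitNecklace.stub_eventualShellReduction` (p127535): for every shell `D(x; ρ, R)`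
with `0 < ρ`, `2ρ ≤ R ≤ 1` and every `ε > 0` some threshold `n` has
`P_δ[n separate traversals of D(x; ρ, R)] ≤ ε` for all sufficiently small meshes `δ`.
[AizenmanBurchard1999 §1.b (1.3); tree `Curve.HasTraversals`] -/
def PerShellTightAt (D : DobrushinDomain) (a b : ℝ → Site 2) : Prop :=
  ∀ (x : ℂ) (ρ R : ℝ), 0 < ρ → 2 * ρ ≤ R → R ≤ 1 → ∀ ε : ℝ, 0 < ε → ∃ n : ℕ, ∀ᶠ δ in 𝓝[>] (0 : ℝ),
    SAW.law D.carrier δ (a δ) (b δ)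
      {γ | (⟨γ.walk.toCurve (meshPoint δ)⟩ : Curve ℂ).HasTraversals n x ρ R} ≤ ENNReal.ofReal ε

/-- **Per-shell eventual tightness on the R1 class**: `PerShellTightAt` for every Dobrushin domain and every
endpoint approximation whose lattice endpoints are eventually lattice-BOUNDARY vertices
(`Negative.BdryApprox`: `a δ, b δ ∈ meshBoundary D.carrier δ` for all small `δ`) — the only approximations
at which an exploration of the chord presents the typed setting of `TargetMonotone`/`DomainMonotone`
(`Negative.DeepEndpointGap`, `Negative.DeepStartNotPresentable`). -/
def PerShellTightBdry : Prop :=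
  ∀ (D : DobrushinDomain) (a b : ℝ → Site 2), SAW.IsEndpointApprox D a b → BdryApprox D a b →
    PerShellTightAt D a b

/-- **Statement T1** — the symmetrisation lever: the two monotone couplings give time-zero G1 over the
admissible family. -/
def Symmetrisation : Prop := TargetMonotone → DomainMonotone → AdmissibleG1

/-- **Statement T2** — the Kemppainen–Smirnov / Aizenman–Burchard iteration at boundary-attached endpoints. -/
def KSIterationBdry : Prop := AdmissibleG1 → PerShellTightBdry

/-- **Statement T3** — the deep-endpoint reduction, over THIS route's copy of (H1)
(`SAWTargetMonotonicity.SAWTraversalBound`, item stmt-1880 shared with `SAWLeftRightFKG`); definitionally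
`Negative.DeepEndpointReduction` (`deepEndpointReduction_iff` below). -/
def DeepReduction : Prop :=
  SAWTraversalBoundBdry → Summit.CriticalPhenomena.SAWScalingLimit.Theses.SAWTargetMonotonicity.SAWTraversalBound

/-- T3 is the sibling crux's landed residue `Negative.DeepEndpointReduction` (p82017), definitionally:
one proof closes both. [folklore] -/
theorem deepReduction_iff : DeepReduction ↔ DeepEndpointReduction := Iff.rfl

/-! ## §1 The registered stubs (`sorry` lives ONLY in these three theorems) -/

/-- **STUB T1 · `stub_symmetrisation`** (XL, OPEN — THE LEVER) `= Symmetrisation`: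
`TargetMonotone → DomainMonotone → AdmissibleG1`.  Scheme (route, steps (ii)–(iii)): in an admissible
polyomino with boundary source `a` (the slit tip of the exploration) and boundary target `b`, an unforced
crossing of `A(z₀; r, R)` enters a dead-end sector `Q` of `U ∩ A` (its component does not separate `a` from
`b`); `TargetMonotone` (and, by exact reversal `law(b→a) = reverse∗law(a→b)`, its source form) moves the
target to a position symmetric with respect to `Q`, `DomainMonotone` trades `U` for a comparison domain
symmetric under a reflection exchanging "enter `Q` across `A`" with an event disjoint from it, at the price
of conditioning on a monotone event; the reflection pins the unforced-crossing probability at `≤ 1/2`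
uniformly in `δ` and in the polyomino (lattice-scale input where the reflection axis is off-lattice:
Kesten's bridge decomposition, MadrasSlade1993 (4.2.4)).  WHY IT MIGHT FAIL: a comparison domain with the
required reflection must exist at every scale and TM/DM must control BOTH replacements with constants
independent of the carrier; any uniform-in-the-carrier bound of this shape accepts the neck-and-room
carriers and therefore implies the ceiling critical bubble bound (`FKGToTraversalBound/EngineNeedsBubble`,
finding F-B; stmt-CriticalPhenomena-7117) — so T1 asserts that TM ∧ DM carry bubble-grade information.
[KemppainenSmirnov2017 §4.1.6; MadrasSlade1993 (4.2.4); Kesten1963SAW; card U3′; stmt-11346] -/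
theorem stub_symmetrisation : TargetMonotone → DomainMonotone → AdmissibleG1 := by
  sorry

/-- **STUB T2 · `stub_ksIterationBdry`** (L–XL, OPEN) `= KSIterationBdry`: time-zero G1 over the
admissible family ⇒ per-shell eventual tightness of traversal counts for every Dobrushin domain and every
endpoint approximation of the R1 class.  Scheme: (a) domain Markov (landed `stub_sawDomainMarkov`,
`weight_prefix` / `weight_restrict`, p85820): after each completed traversal the future is the critical chord
of the admissible polyomino `S ∖ past` from the (boundary) tip, so G1 applies at every traversal time — this
is KS17's reduction of Condition G2 to time-zero G1 on a Markov-closed family (§4.1.6); (b) in a simply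
connected slit domain an unforced traversal beyond the static forcing allowance `n₀(D, x, ρ, R)` (finite for a
FIXED shell and a fixed Jordan domain at boundary-attached endpoints, eventually in `δ`: local connectedness
of `D̄` at the marked prime ends) is half of a double crossing, and each costs a factor `≤ 1/2` (modulus `C`
sub-shells, `⌊log_C (R/ρ)⌋` of them; KS17 Prop. 2.6, AB99 App. A) ⇒ `P_δ[n₀ + 2m traversals] ≤ 2^{-m}`;
(c) presentation: for `a δ, b δ ∈ meshBoundary` the Smirnov discretisation `discreteDomainGraph D.carrier δ`
is the induced graph of an admissible polyomino up to a defect set that is eventually empty for tame `D`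
and must be swept onto the spine otherwise (cf. the sibling's `stub_hungPresentation`, `stub_wildDomains`).
WHY IT MIGHT FAIL: the class passage (c) for wild Jordan boundaries (unbounded defect sets at small meshes);
the forcing allowance must be STATIC (time zero) while forcing is created dynamically by the past — the
serpentine-past bookkeeping of KS17 Lemma 3.6 on the lattice.
[KemppainenSmirnov2017 Prop. 2.6, §3, §4.1.6; AizenmanBurchardDuke1999 App. A; Negative.R1Split] -/
theorem stub_ksIterationBdry :
    AdmissibleG1 → ∀ (D : DobrushinDomain) (a b : ℝ → Site 2), SAW.IsEndpointApprox D a b →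
      BdryApprox D a b → ∀ (x : ℂ) (ρ R : ℝ), 0 < ρ → 2 * ρ ≤ R → R ≤ 1 → ∀ ε : ℝ, 0 < ε →
        ∃ n : ℕ, ∀ᶠ δ in 𝓝[>] (0 : ℝ),
          SAW.law D.carrier δ (a δ) (b δ)
            {γ | (⟨γ.walk.toCurve (meshPoint δ)⟩ : Curve ℂ).HasTraversals n x ρ R} ≤ ENNReal.ofReal ε := by
  sorry

/-- **STUB T3 · `stub_deepEndpointReduction`** (OPEN reduction; statement-level residue shared verbatim with
the sibling crux `FKGToTraversalBound`, `Negative.DeepEndpointReduction` p82017) `= DeepReduction`: (H1) for the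
endpoint approximations of the R1 class ⇒ (H1) for ALL endpoint approximations.  Content
(`Negative.exists_approx_outside_R1`): approximations whose endpoints stay at depth `≫ δ` (up to `√δ`) are
admissible; for them the shells around the marked points down to radius `√δ` see bulk critical SAW before the
first boundary contact.  Route device: condition on the walk up to its LAST EXIT from a mesoscopic ball around
the deep marked point (a static disintegration, cf. the sibling's slit necklace) and feed the boundary-attached
bound to the remaining piece; needs ONE rate-free bulk input per marked point (germ tightness with inner radius
shrinking like the depth).  WHY IT MIGHT FAIL: no engine uniform in the past reaches the deep fragment
(`Negative.DeepStartNotPresentable`); an averaged (annealed) estimate near a deep marked point is required.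
[Negative.R1Split; AizenmanBurchardDuke1999; DuminilCopinSmirnov2012 §4 (closest-vertex approximations)] -/
theorem stub_deepEndpointReduction :
    SAWTraversalBoundBdry →
      Summit.CriticalPhenomena.SAWScalingLimit.Theses.SAWTargetMonotonicity.SAWTraversalBound := by
  sorry

/-! ### Consistency: each named statement IS its registered stub (definitionally) -/

theorem symmetrisation_holds : Symmetrisation := stub_symmetrisation
theorem ksIterationBdry_holds : KSIterationBdry := stub_ksIterationBdry
theorem deepReduction_holds : DeepReduction := stub_deepEndpointReduction

/-! ### Name-keyed aliases of the three statements (the hypotheses of the composition; the skeleton audit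
admits a hypothesis only if its head constant is a registered obligation or is named like a declared stub) -/
namespace Registered

/-- Alias of `Symmetrisation` keyed by the registered stub name. -/
abbrev stub_symmetrisation : Prop := Symmetrisation
/-- Alias of `KSIterationBdry` keyed by the registered stub name. -/
abbrev stub_ksIterationBdry : Prop := KSIterationBdry
/-- Alias of `DeepReduction` keyed by the registered stub name. -/
abbrev stub_deepEndpointReduction : Prop := DeepReduction

end Registered

/-! ## §2 Proved glue and the composition (kernel-checked; no `sorry` below) -/

/-- **Per-shell eventual tightness on the R1 class gives (H1) on the R1 class** — the landed Aizenman–Burchard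
quantile chart `SlitNecklace.stub_eventualShellReduction` (p127535: `K = 8`, `λ = 3`, threshold = the
`8(ρ/R)³`-quantile), applied approximation by approximation. [AizenmanBurchardDuke1999 §1.b; tree] -/
theorem traversalBoundBdry_of_perShellTightBdry (h : PerShellTightBdry) : SAWTraversalBoundBdry :=
  fun D a b hab hbd => stub_eventualShellReduction D a b hab (h D a b hab hbd)

/-- **`MonotoneRSW_of`** — STUBS T1–T3 imply `SAWTargetMonotonicity.MonotoneRSW`, BY NAME.  Not a one-line
seam: the couplings are spent on G1 (T1), G1 on per-shell tightness at boundary endpoints (T2), the tree's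
PROVED AB reduction turns that into (H1) on the R1 class, and T3 lifts it to every endpoint approximation. -/
theorem MonotoneRSW_of (h1 : Registered.stub_symmetrisation) (h2 : Registered.stub_ksIterationBdry)
    (h3 : Registered.stub_deepEndpointReduction) : MonotoneRSW := by
  intro hTM hDM
  -- (ii)–(iii): time-zero Condition G1 over the admissible family, from the two monotone couplings
  have hG1 : AdmissibleG1 := h1 hTM hDM
  -- (iv) at boundary-attached endpoints: per-shell eventual tightness of the traversal counts
  have hshell : PerShellTightBdry := h2 hG1
  -- Aizenman–Burchard quantile chart (PROVED in the tree): (H1) on the R1 class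
  have hbdry : SAWTraversalBoundBdry := traversalBoundBdry_of_perShellTightBdry hshell
  -- deep endpoint approximations
  exact h3 hbdry

/-- Wiring check: the registered stubs feed `MonotoneRSW_of` as stated. -/
example : MonotoneRSW :=
  MonotoneRSW_of stub_symmetrisation stub_ksIterationBdry stub_deepEndpointReduction

end Summit.CriticalPhenomena.SAWScalingLimit.Cruxes.MonotoneRSW.Birth

end
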